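import Mathlib
import Summits.ResolutionOfSingularities.ResolutionOfSingularities.Theses.FrobeniusLadder

/-!
# Sketch — crux-ideate round 1, ideator 2, crux `FInjectiveMacaulayfication`
(stmt-ResolutionOfSingularities-15315, route FrobeniusLadder)

First lemmas of the two idea cards, stated over Mathlib in the crux's own language
(`CMFI` below is the crux's stalk predicate, verbatim, for an abstract ring).

* card `fedder-embedded-f-purification`  : `FedderHypersurfaceCMFI`
* card `weighted-cone-deformation-descent`: `DeformationCMFI`, `SplitDescentFrobClosed`

Nothing here is proved; everything must elaborate (`lean check` rc 0).
-/

namespace Summit.ResolutionOfSingularities.ResolutionOfSingularities.Cruxes.FInjectiveMacaulayfication.Ideator2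

/-- The crux's stalk predicate, verbatim, for an abstract commutative ring `S` of characteristic
`p`: every system of parameters (d = dim S elements whose ideal has maximal radical) is a weakly
regular sequence and generates a Frobenius-closed ideal. (CM + F-injective, Fedder / Quy–Shimomoto.) -/
def CMFI (p : ℕ) (S : Type) [CommRing S] : Prop :=
  ∀ d : ℕ, ringKrullDim S = d → ∀ s : Fin d → S, (Ideal.span (Set.range s)).radical.IsMaximal →
    RingTheory.Sequence.IsWeaklyRegular S (List.ofFn s) ∧
    ∀ y : S, (∃ e : ℕ, y ^ p ^ e ∈
        Ideal.span ((fun z : S => z ^ p ^ e) '' (Ideal.span (Set.range s) : Set S))) →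
      y ∈ Ideal.span (Set.range s)

/-- Frobenius bracket power `I^[p]` : the ideal generated by `p`-th powers of elements of `I`. -/
def frobPow (p : ℕ) {S : Type} [CommRing S] (I : Ideal S) : Ideal S :=
  Ideal.span ((fun z : S => z ^ p) '' (I : Set S))

/-- FIRST LEMMA of card `fedder-embedded-f-purification` (Fedder 1983, Prop. 1.7 / Thm. 1.12,
sufficient direction, in the crux's language and over an ARBITRARY regular local ring of
characteristic `p` — no F-finiteness: reduce to the F-finite case by the faithfully flat maps
`R → R̂ = k[[x]] → k^{perf}[[x]]`, along which `f^{p-1} ∉ 𝔪^[p]` is preserved and F-purity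
descends): if `R` is regular local, `f ∈ 𝔪`, `f ≠ 0` and `f^{p-1} ∉ 𝔪^[p]`, then the hypersurface
ring `R ⧸ (f)` is Cohen–Macaulay with every parameter ideal Frobenius closed. -/
def FedderHypersurfaceCMFI : Prop :=
  ∀ p : ℕ, p.Prime → ∀ (R : Type) [CommRing R] [IsLocalRing R] [IsNoetherianRing R] [CharP R p],
    IsRegularLocalRing R → ∀ f : R, f ∈ IsLocalRing.maximalIdeal R → f ≠ 0 →
      f ^ (p - 1) ∉ frobPow p (IsLocalRing.maximalIdeal R) →
      CMFI p (R ⧸ Ideal.span ({f} : Set R))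

/-- Pointwise Fedder defect used as the game's local measure (card `fedder-embedded-f-purification`):
`ν_f(p^e) = max { r | f^r ∉ 𝔪^[p^e] }`; F-pure at `𝔪` iff `ν_f(p) = p - 1`. Stated as a predicate
"`f^r ∉ 𝔪^[q]`" to avoid `Nat.find` bookkeeping. -/
def FedderNonMember (q r : ℕ) {R : Type} [CommRing R] [IsLocalRing R] (f : R) : Prop :=
  f ^ r ∉ frobPow q (IsLocalRing.maximalIdeal R)

/-- FIRST LEMMA of card `weighted-cone-deformation-descent` (Fedder 1983 Thm 3.4(1) "F-injectivity
+ CM deforms", with CM deformation, in the crux's language): if `x ∈ 𝔪` is a non-zero-divisor of a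
Noetherian local ring `R` of characteristic `p` and `R ⧸ (x)` is CMFI, then `R` is CMFI. -/
def DeformationCMFI : Prop :=
  ∀ p : ℕ, p.Prime → ∀ (R : Type) [CommRing R] [IsLocalRing R] [IsNoetherianRing R] [CharP R p],
    ∀ x : R, x ∈ IsLocalRing.maximalIdeal R → x ∈ nonZeroDivisors R →
      CMFI p (R ⧸ Ideal.span ({x} : Set R)) → CMFI p R

/-- SECOND LEMMA of card `weighted-cone-deformation-descent`, elementwise half of the degree-zero
direct-summand descent (the Cohen–Macaulay half goes through local cohomology): if `i : A →+* B`
has an `A`-linear retraction `r` (`r (i a * b) = a * r b`, `r (i a) = a`), and the expansion of an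
ideal `I` of `A` to `B` is Frobenius closed, then `I` is Frobenius closed. -/
def SplitDescentFrobClosed : Prop :=
  ∀ p : ℕ, p.Prime → ∀ (A B : Type) [CommRing A] [CommRing B] [CharP A p] [CharP B p]
    (i : A →+* B) (r : B → A), (∀ a : A, r (i a) = a) → (∀ (a : A) (b : B), r (i a * b) = a * r b) →
    (∀ b b' : B, r (b + b') = r b + r b') →
    ∀ I : Ideal A,
      (∀ y : B, (∃ e : ℕ, y ^ p ^ e ∈
          Ideal.span ((fun z : B => z ^ p ^ e) '' (I.map i : Set B))) → y ∈ I.map i) →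
      ∀ y : A, (∃ e : ℕ, y ^ p ^ e ∈ Ideal.span ((fun z : A => z ^ p ^ e) '' (I : Set A))) → y ∈ I

/-- Sanity: the crux decl is in scope (the cards' transfers conclude it BY NAME downstream). -/
example : Prop := Summit.ResolutionOfSingularities.ResolutionOfSingularities.Theses.FrobeniusLadder.FInjectiveMacaulayfication

end Summit.ResolutionOfSingularities.ResolutionOfSingularities.Cruxes.FInjectiveMacaulayfication.Ideator2
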